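import Summits.AtomisticToContinuum.BoseEinsteinCondensation.Theses.BECCutLineWeakDisorder
import Summits.AtomisticToContinuum.BoseEinsteinCondensation.Theorems.BECCutLineWeakDisorderWitnessTransferRatio
import Literature.MathematicalPhysics.QuantumManyBody.GroundStateFeynmanKacPositivity
import Literature.MathematicalPhysics.QuantumManyBody.MeanSelfDensity

/-!
# `TwoReplicaTransienceBound` (crux stmt-AtomisticToContinuum-9687, route `BECCutLineWeakDisorder`):
# the constant cannot go below `1` — the strengthening `C < 1` is FALSE, and the flat-datum
# witness is non-degenerate for bounded `v` (negative-side support, crux disprover seat)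

The crux bounds `R_T := ∫ L³ m_T(Y)²/s_T(Y)² dY ≤ C` for the finite-`T` Feynman–Kac witnesses
`Ψ_T = fkWitness v L T 1 = e^{-TH}1/‖e^{-TH}1‖₂`. Here we record, sorry-free:

* `one_le_lintegral_ratio` — for ANY measurable, bounded, `L²`-normalised function vanishing off the
  box, `R_L(f) ≥ 1` (Cauchy–Schwarz in the slice `x ↦ f(x::Y)` against `𝟙_Λ`, then Fubini over
  the first particle: `∫ L³m²/s² ≥ ∫ m = ‖f‖₂² = 1`). In DPRE words `E[W²] ≥ (E W)² = 1`.
* `fkNormSq_one_ne_top`, `fkNormSq_one_ne_zero` — `0 < ‖e^{-TH}1‖₂² < ∞` for BOUNDED measurable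
  `v`, `L > 0`, `T > 0` (positive survival `fkReal_one_pos`; `Z_T ≤ 1` off/on the box): the
  witness is a genuine normalised Dirichlet function, the crux is NOT vacuous by degeneracy there
  (hard cores: non-degeneracy at low density is part of `WitnessTransfer`).
* `one_le_lintegral_ratio_fkWitness` — hence the crux's integral is `≥ 1` for bounded `v`.
* `not_twoReplicaTransienceBound_below_one` — the natural strengthening of the crux with `C < 1`
  (stated inline; no proposition is defined here and nothing under `Theses/` is touched) is
  false: witness the free gas `v = 0` (admissible), any density, any `n`, `T = 1`.

So the crux's constant lives in `[1, ∞)`; the conjectured sharp value is the free Dirichlet gas'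
`sup_T R_T = (π²/8)³ ≈ 1.878` (refuter FreeGasCheck; not formalised — Dirichlet heat-kernel
eigen-expansion). This file does NOT refute the crux.
-/

noncomputable section

namespace Summit.AtomisticToContinuum.BoseEinsteinCondensation.Theorems.TwoReplicaTransienceBound.Negative

open MeasureTheory Filter Set
open scoped ENNReal NNReal Topology
open Literature.MathematicalPhysics.QuantumManyBody.BoseGas
open Summit.AtomisticToContinuum.BoseEinsteinCondensation.Theorems.CutLineWitness

variable {n : ℕ}

/-- **Slice Cauchy–Schwarz**: for a slice supported in `Λ_L` with finite mass,
`m(Y) ≤ L³ m(Y)²/s(Y)²` (i.e. `s² ≤ |Λ| m`). -/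
theorem slice_le_ratio {L : ℝ} (hL : 0 ≤ L) {g : Space → ℝ} (hg : Measurable g)
    (hsupp : ∀ x, x ∉ box L → g x = 0) (hfin : ∫⁻ x, (‖g x‖₊ : ℝ≥0∞) ≠ ⊤) :
    ∫⁻ x, (‖g x‖₊ : ℝ≥0∞) ^ 2 ≤
      ENNReal.ofReal (L ^ 3) * (∫⁻ x, (‖g x‖₊ : ℝ≥0∞) ^ 2) ^ 2 / (∫⁻ x, (‖g x‖₊ : ℝ≥0∞)) ^ 2 := by
  set m := ∫⁻ x, (‖g x‖₊ : ℝ≥0∞) ^ 2 with hm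
  set s := ∫⁻ x, (‖g x‖₊ : ℝ≥0∞) with hs
  have hgm : Measurable fun x => (‖g x‖₊ : ℝ≥0∞) := hg.nnnorm.coe_nnreal_ennreal
  -- Cauchy–Schwarz against the indicator of the box: `s² ≤ |Λ_L| m`
  have hcs : s ^ 2 ≤ ENNReal.ofReal (L ^ 3) * m := by
    have hind : ∀ x, (‖g x‖₊ : ℝ≥0∞) = (box L).indicator (fun _ => (1 : ℝ≥0∞)) x * ‖g x‖₊ := by
      intro x
      by_cases hx : x ∈ box L
      · simp [Set.indicator_of_mem hx]
      · simp [Set.indicator_of_notMem hx, hsupp x hx]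
    have h1 := ENNReal.lintegral_mul_le_Lp_mul_Lq volume Real.HolderConjugate.two_two
      (f := (box L).indicator fun _ => (1 : ℝ≥0∞)) (g := fun x => (‖g x‖₊ : ℝ≥0∞))
      ((measurable_const.indicator (measurableSet_box L)).aemeasurable) hgm.aemeasurable
    have hI : ∫⁻ x, (box L).indicator (fun _ => (1 : ℝ≥0∞)) x ^ (2 : ℝ) = ENNReal.ofReal (L ^ 3) := by
      have : ∀ x, (box L).indicator (fun _ => (1 : ℝ≥0∞)) x ^ (2 : ℝ) =
          (box L).indicator (fun _ => (1 : ℝ≥0∞)) x := fun x => by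
        by_cases hx : x ∈ box L <;> simp [hx]
      simp_rw [this]
      rw [lintegral_indicator (measurableSet_box L), setLIntegral_const, one_mul, volume_box,
        ENNReal.ofReal_pow hL]
    calc s ^ 2 = (∫⁻ x, (box L).indicator (fun _ => (1 : ℝ≥0∞)) x * ‖g x‖₊) ^ 2 := by
          rw [hs]; congr 1; exact lintegral_congr fun x => hind x
      _ ≤ ((∫⁻ x, (box L).indicator (fun _ => (1 : ℝ≥0∞)) x ^ (2 : ℝ)) ^ (1 / (2 : ℝ)) *
            (∫⁻ x, (‖g x‖₊ : ℝ≥0∞) ^ (2 : ℝ)) ^ (1 / (2 : ℝ))) ^ 2 := by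
          gcongr; simpa only [Pi.mul_apply] using h1
      _ = ENNReal.ofReal (L ^ 3) * m := by
          rw [hI, mul_pow, ← ENNReal.rpow_two, ← ENNReal.rpow_two, ← ENNReal.rpow_mul,
            ← ENNReal.rpow_mul, hm]
          norm_num
  rcases eq_or_ne s 0 with h0 | h0
  · -- `s = 0`: the slice vanishes a.e., so `m = 0`
    have hae : (fun x => (‖g x‖₊ : ℝ≥0∞)) =ᵐ[volume] 0 := (lintegral_eq_zero_iff hgm).1 h0
    have hm0 : m = 0 := by
      rw [hm, lintegral_eq_zero_iff (hgm.pow_const 2)]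
      filter_upwards [hae] with x hx
      simp [hx]
    rw [hm0]; exact bot_le
  have h2 : s ^ 2 ≠ 0 := pow_ne_zero _ h0
  have h2t : s ^ 2 ≠ ⊤ := ENNReal.pow_ne_top hfin
  calc m = m * (s ^ 2 / s ^ 2) := by rw [ENNReal.div_self h2 h2t, mul_one]
    _ ≤ m * (ENNReal.ofReal (L ^ 3) * m / s ^ 2) := by gcongr
    _ = ENNReal.ofReal (L ^ 3) * m ^ 2 / s ^ 2 := by rw [← mul_div_assoc]; ring_nf

/-- **The floor of the crux's functional**: an `L²`-normalised, bounded, Dirichlet function has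
`R_L(f) ≥ 1` (slice Cauchy–Schwarz + Fubini). Hence NO admissible constant `C < 1` — the natural
strengthening `C < 1` of the crux is false whenever the witness is non-degenerate. -/
theorem one_le_lintegral_ratio {L : ℝ} (hL : 0 ≤ L) {f : Config (n + 1) → ℝ} (hf : Measurable f)
    (hsupp : ∀ X, X ∉ boxN (n + 1) L → f X = 0) {K : ℝ} (hK : ∀ X, |f X| ≤ K)
    (hnorm : ∫⁻ X, (‖f X‖₊ : ℝ≥0∞) ^ 2 = 1) :
    1 ≤ (∫⁻ Y : Config n, ENNReal.ofReal (L ^ 3) *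
      (∫⁻ x, (‖f (Matrix.vecCons x Y)‖₊ : ℝ≥0∞) ^ 2) ^ 2 /
        (∫⁻ x, (‖f (Matrix.vecCons x Y)‖₊ : ℝ≥0∞)) ^ 2) := by
  have hslice : ∀ Y : Config n, ∫⁻ x, (‖f (Matrix.vecCons x Y)‖₊ : ℝ≥0∞) ^ 2 ≤
      ENNReal.ofReal (L ^ 3) * (∫⁻ x, (‖f (Matrix.vecCons x Y)‖₊ : ℝ≥0∞) ^ 2) ^ 2 /
        (∫⁻ x, (‖f (Matrix.vecCons x Y)‖₊ : ℝ≥0∞)) ^ 2 := by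
    intro Y
    by_cases hY : Y ∈ boxN n L
    · have hsx : ∀ x, x ∉ box L → f (Matrix.vecCons x Y) = 0 := fun x hx =>
        hsupp _ fun h => hx ((vecCons_mem_boxN_iff.1 h).1)
      refine slice_le_ratio hL (measurable_slice hf Y) hsx ?_
      exact ne_top_of_le_ne_top (ENNReal.mul_ne_top ENNReal.ofReal_ne_top (volume_box_ne_top L))
        (lintegral_nnnorm_le_of_bound (fun x => hK _) hsx)
    · have h0 : ∀ x, f (Matrix.vecCons x Y) = 0 := fun x =>
        hsupp _ fun h => hY ((vecCons_mem_boxN_iff.1 h).2)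
      simp [h0]
  calc (1 : ℝ≥0∞) = ∫⁻ X, (‖f X‖₊ : ℝ≥0∞) ^ 2 := hnorm.symm
    _ = ∫⁻ Y : Config n, ∫⁻ x, (‖f (Matrix.vecCons x Y)‖₊ : ℝ≥0∞) ^ 2 :=
        lintegral_eq_lintegral_lintegral_vecCons (hf.nnnorm.coe_nnreal_ennreal.pow_const 2)
    _ ≤ _ := lintegral_mono hslice

/-! ### Non-degeneracy of the flat-datum normalisation `‖e^{-TH}1‖₂²` -/

/-- `‖Z_T‖₂² ≤ |Λ_L^N| < ∞` (`T ≥ 0`): `Z_T ≤ 1` and `Z_T = 0` off the box. -/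
theorem fkNormSq_one_ne_top {N : ℕ} (v : ℝ → ℝ≥0∞) (L : ℝ) {T : ℝ} (hT : 0 ≤ T) :
    fkNormSq (N := N) v L T (fun _ => (1 : ℝ≥0∞)) ≠ ⊤ := by
  refine ne_top_of_le_ne_top (volume_boxN_lt_top N L).ne ?_
  rw [fkNormSq, ← setLIntegral_one, ← lintegral_indicator (measurableSet_boxN N L)]
  refine lintegral_mono fun X => ?_
  by_cases hX : X ∈ boxN N L
  · rw [Set.indicator_of_mem hX]
    calc fkSemigroup v L T (fun _ => 1) X ^ 2 ≤ 1 ^ 2 := by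
          gcongr; exact fkPartition_le_one v L T X
      _ = 1 := one_pow 2
  · rw [Set.indicator_of_notMem hX, fkSemigroup_of_notMem v hT _ hX]; simp

/-- `‖Z_T‖₂² ≠ 0` for BOUNDED measurable `v`, `L > 0`, `T > 0`: `Z_T > 0` on the open box
(positive survival, `fkReal_one_pos`) and the box has positive volume. (For hard cores — `v = ⊤`
on an interval, admissible — non-degeneracy at low density is part of `WitnessTransfer`.) -/
theorem fkNormSq_one_ne_zero {N : ℕ} {v : ℝ → ℝ≥0∞} (hv : Measurable v) {C : ℝ≥0}
    (hC : ∀ r, v r ≤ C) {L : ℝ} (hL : 0 < L) {T : ℝ} (hT : 0 < T) :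
    fkNormSq (N := N) v L T (fun _ => (1 : ℝ≥0∞)) ≠ 0 := by
  have hpos : ∀ X ∈ boxN N L, 0 < fkSemigroup v L T (fun _ => (1 : ℝ≥0∞)) X := by
    intro X hX
    have h := fkReal_one_pos (N := N) hv hC hT hX
    rw [fkReal_eq_toReal_fkSemigroup hv L T measurable_const (fun _ => zero_le_one) X] at h
    simp only [ENNReal.ofReal_one] at h
    exact pos_iff_ne_zero.2 fun h0 => h.ne' (by rw [h0, ENNReal.toReal_zero])
  have hm : Measurable fun X : Config N => fkSemigroup v L T (fun _ => (1 : ℝ≥0∞)) X ^ 2 :=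
    (measurable_fkSemigroup (N := N) hv L T measurable_const).pow_const 2
  rw [fkNormSq, ← pos_iff_ne_zero, lintegral_pos_iff_support hm]
  have hsub : boxN N L ⊆
      Function.support fun X : Config N => fkSemigroup v L T (fun _ => (1 : ℝ≥0∞)) X ^ 2 :=
    fun X hX => by simpa [Function.mem_support] using (hpos X hX).ne'
  refine lt_of_lt_of_le ?_ (measure_mono hsub)
  rw [volume_boxN]
  exact ENNReal.pow_pos (ENNReal.pow_pos (ENNReal.ofReal_pos.2 hL) 3) N

/-- **The crux's integral is at least `1`** for bounded measurable `v`, `L > 0`, `T > 0`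
(the flat-datum witness is then a genuine `L²`-normalised Dirichlet function). -/
theorem one_le_lintegral_ratio_fkWitness {v : ℝ → ℝ≥0∞} (hv : Measurable v) {C : ℝ≥0}
    (hC : ∀ r, v r ≤ C) {L : ℝ} (hL : 0 < L) {T : ℝ} (hT : 0 < T) :
    1 ≤ (∫⁻ Y : Config n, ENNReal.ofReal (L ^ 3) *
      (∫⁻ x, (‖fkWitness (N := n + 1) v L T (fun _ => (1 : ℝ≥0∞)) (Matrix.vecCons x Y)‖₊ : ℝ≥0∞) ^ 2) ^ 2 /
        (∫⁻ x, (‖fkWitness (N := n + 1) v L T (fun _ => (1 : ℝ≥0∞)) (Matrix.vecCons x Y)‖₊ : ℝ≥0∞)) ^ 2) := by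
  set 𝒩 := fkNormSq (N := n + 1) v L T (fun _ => (1 : ℝ≥0∞)) with h𝒩
  have h0 : 𝒩 ≠ 0 := fkNormSq_one_ne_zero hv hC hL hT
  have htop : 𝒩 ≠ ⊤ := fkNormSq_one_ne_top v L hT.le
  set f := fkWitness (N := n + 1) v L T (fun _ => (1 : ℝ≥0∞)) with hf
  have hfm : Measurable f := measurable_fkWitness hv L T measurable_const
  have hsupp : ∀ X, X ∉ boxN (n + 1) L → f X = 0 := fun X hX => fkWitness_of_notMem v hT.le _ hX
  have hK : ∀ X, |f X| ≤ (Real.sqrt 𝒩.toReal)⁻¹ := by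
    intro X
    rw [abs_of_nonneg (fkWitness_nonneg v L T _ X), fkWitness_apply, div_eq_mul_inv]
    refine mul_le_of_le_one_left (inv_nonneg.2 (Real.sqrt_nonneg _)) ?_
    have := ENNReal.toReal_mono ENNReal.one_ne_top (fkPartition_le_one v L T X)
    simpa [fkPartition] using this
  have hnorm : ∫⁻ X, (‖f X‖₊ : ℝ≥0∞) ^ 2 = 1 := by
    rw [← lintegral_fkWitness_sq hv L T measurable_const h0 htop]
    refine lintegral_congr fun X => ?_
    rw [← enorm_eq_nnnorm, Real.enorm_of_nonneg (fkWitness_nonneg v L T _ X)]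
  exact one_le_lintegral_ratio hL.le hfm hsupp hK hnorm

/-- **Refutation of the strengthening `C < 1`** (witness: the FREE gas `v = 0`, any density, any
large `n`, `T = 1`: the witness is non-degenerate and `R ≥ 1`). So the crux's constant is pinned in
`[1, ∞)`; the conjectured sharp value is the free Dirichlet gas' `sup_T R_T = (π²/8)³ ≈ 1.878`
(attained as `T → ∞`; not formalised: needs the Dirichlet heat-kernel eigen-expansion). -/
theorem not_twoReplicaTransienceBound_below_one :
    ¬ (∀ v : ℝ → ℝ≥0∞, IsRepulsiveFiniteRange v → ∃ ρ₀ : ℝ, 0 < ρ₀ ∧ ∀ ρ : ℝ, 0 < ρ → ρ < ρ₀ →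
      ∃ C : ℝ, C < 1 ∧ ∀ᶠ n : ℕ in Filter.atTop, ∀ T : ℝ, 1 ≤ T →
        ∫⁻ Y : Config n, ENNReal.ofReal (sideLength ρ (n + 1) ^ 3) *
          (∫⁻ x, (‖fkWitness (N := n + 1) v (sideLength ρ (n + 1)) T (fun _ => (1 : ℝ≥0∞))
            (Matrix.vecCons x Y)‖₊ : ℝ≥0∞) ^ 2) ^ 2 /
          (∫⁻ x, (‖fkWitness (N := n + 1) v (sideLength ρ (n + 1)) T (fun _ => (1 : ℝ≥0∞))
            (Matrix.vecCons x Y)‖₊ : ℝ≥0∞)) ^ 2 ≤ ENNReal.ofReal C) := by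
  intro h
  have hv : IsRepulsiveFiniteRange (fun _ : ℝ => (0 : ℝ≥0∞)) := ⟨measurable_const, 0, fun _ _ => rfl⟩
  obtain ⟨ρ₀, hρ₀, H⟩ := h _ hv
  obtain ⟨C, hC1, hev⟩ := H (ρ₀ / 2) (by positivity) (by linarith)
  obtain ⟨n, hn⟩ := hev.exists
  have hL : 0 < sideLength (ρ₀ / 2) (n + 1) :=
    Real.rpow_pos_of_pos (div_pos (by exact_mod_cast Nat.succ_pos n) (by positivity)) _
  have h1 := one_le_lintegral_ratio_fkWitness (n := n) (v := fun _ => (0 : ℝ≥0∞)) measurable_const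
    (C := 0) (fun _ => le_rfl) hL one_pos
  have h2 := hn 1 le_rfl
  have : (1 : ℝ≥0∞) < 1 := (h1.trans h2).trans_lt (ENNReal.ofReal_lt_one.2 hC1)
  exact lt_irrefl _ this



end Summit.AtomisticToContinuum.BoseEinsteinCondensation.Theorems.TwoReplicaTransienceBound.Negative

end
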